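import Mathlib
import HarnessLib
import Summits.NavierStokesRegularity.NavierStokesRegularity.Theorems.IsobarTomographyTubeAlternativeStubTwoSidedVorticityRate

/-!
# `TubeAlternative` (stmt-NavierStokesRegularity-11739), line `analytic-propagation-local-patch`:
# stub `stub_antiBlobPeaks` (what the failed blob hypothesis actually delivers)

The crux's hypothesis "the blob hypothesis fails" quantifies over every threshold function
`Ω : ℝ → ℝ`. Tested with the threshold `Ω(t) = θ · sup_x ‖ω(t,x)‖` (finite and positive for late `t`
by the two-sided Type-I vorticity law `stub_twoSidedVorticityRate`, landed), it says exactly: for every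
`κ > 0`, every `θ ∈ (0,1)` and every `t₀ < T` there is a later time `t` and a `θ`-near-maximal vorticity
point `x` at which the axial pressure convexity FAILS at level `κ`,
`D²p(t)[ω,ω](x) < κ ‖ω(t,x)‖² Δp(t)(x)` — the ANTI-BLOB PEAKS. This is the whole first-order content
of `¬ blob` that the line's bet (`stub_peakActionDecayOfAntiBlobPeaks`) consumes.
-/

noncomputable section

-- the summit and its single problem share the name (D-0017 nested layout)
set_option linter.dupNamespace false

open scoped InnerProductSpace RealInnerProductSpace
open Literature.Analysis.FluidPDE Set Function Filter

namespace Summit.NavierStokesRegularity.NavierStokesRegularity.Theorems.TubeAlternative.AnalyticPropagation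

/-- Physical space `ℝ³`. -/
local notation "E3" => EuclideanSpace ℝ (Fin 3)

/-- **Anti-blob peaks (stub `stub_antiBlobPeaks` of line `analytic-propagation-local-patch`).** At a
Type-I singular time of a maximal Leray–Hopf classical solution from a rapidly decaying datum where the
blob hypothesis fails, for every `κ > 0`, `θ ∈ (0,1)` and `t₀ ∈ [0,T)` there are `t ∈ [t₀,T)` and a
`θ`-near-maximal vorticity point `x` (`θ‖ω(t,y)‖ ≤ ‖ω(t,x)‖` for all `y`, `ω(t,x) ≠ 0`) with
`D²p(t)[ω,ω](x) < κ‖ω(t,x)‖²Δp(t)(x)`. Proof: test the failed blob hypothesis with the threshold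
`Ω(t) = θ · sup_x ‖curl (u t) x‖`, which is finite and positive on a final interval `[t₁, T)` by the
two-sided vorticity law `stub_twoSidedVorticityRate`. [folklore] -/
theorem stub_antiBlobPeaks :
    ∀ (ν T : ℝ), 0 < ν → 0 < T → ∀ (u : ℝ → E3 → E3) (p : ℝ → E3 → ℝ),
    IsMaximalSmoothSolution ν 0 u p T → IsLerayHopfOn T ν 0 (u 0) u →
    HasRapidSpatialDecay (u 0) → IsTypeIBlowup u T →
    (¬ ∃ κ : ℝ, 0 < κ ∧ ∃ Ω : ℝ → ℝ, ∃ t₀ ∈ Set.Ico 0 T, ∀ t ∈ Set.Ico t₀ T,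
      (∃ x : E3, Ω t < ‖curl (u t) x‖) ∧ ∀ x : E3, Ω t < ‖curl (u t) x‖ →
        κ * ‖curl (u t) x‖ ^ 2 * Laplacian.laplacian (p t) x ≤
          iteratedFDeriv ℝ 2 (p t) x ![curl (u t) x, curl (u t) x]) →
    ∀ κ θ : ℝ, 0 < κ → 0 < θ → θ < 1 → ∀ t₀ ∈ Set.Ico 0 T, ∃ t ∈ Set.Ico t₀ T, ∃ x : E3,
      0 < ‖curl (u t) x‖ ∧ (∀ y : E3, θ * ‖curl (u t) y‖ ≤ ‖curl (u t) x‖) ∧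
      iteratedFDeriv ℝ 2 (p t) x ![curl (u t) x, curl (u t) x] <
        κ * ‖curl (u t) x‖ ^ 2 * Laplacian.laplacian (p t) x := by
  intro ν T hν hT u p hmax hLH hdec hI hnb κ θ hκ hθ hθ1 t₀ ht₀
  -- the two-sided vorticity law on a final interval `[t₁, T)`
  obtain ⟨c, C, hc, t₁, ht₁, hrate⟩ := stub_twoSidedVorticityRate ν T hν hT u p hmax hLH hdec hI
  -- the threshold `Ω(t) = θ · sup_x ‖curl (u t) x‖`
  set S : ℝ → ℝ := fun t => sSup (Set.range fun x : E3 => ‖curl (u t) x‖) with hS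
  have hbdd : ∀ t ∈ Set.Ico t₁ T, BddAbove (Set.range fun x : E3 => ‖curl (u t) x‖) := by
    intro t ht
    refine ⟨C / (T - t), ?_⟩
    rintro _ ⟨x, rfl⟩
    exact (hrate t ht).2 x
  have hle : ∀ t ∈ Set.Ico t₁ T, ∀ y : E3, ‖curl (u t) y‖ ≤ S t := fun t ht y =>
    le_csSup (hbdd t ht) ⟨y, rfl⟩
  have hSpos : ∀ t ∈ Set.Ico t₁ T, 0 < S t := by
    intro t ht
    obtain ⟨x, hx⟩ := (hrate t ht).1
    have hTt : 0 < T - t := sub_pos.2 ht.2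
    exact lt_of_lt_of_le (div_pos hc hTt) (hx.trans (hle t ht x))
  -- the later starting time `t₀' = max t₀ t₁`
  set t₀' : ℝ := max t₀ t₁ with ht₀'
  have ht₀'mem : t₀' ∈ Set.Ico 0 T := ⟨ht₀.1.trans (le_max_left _ _), max_lt ht₀.2 ht₁.2⟩
  -- test the failed blob hypothesis with `(κ, θ S, t₀')`
  have key : ¬ ∀ t ∈ Set.Ico t₀' T, (∃ x : E3, θ * S t < ‖curl (u t) x‖) ∧
      ∀ x : E3, θ * S t < ‖curl (u t) x‖ →
        κ * ‖curl (u t) x‖ ^ 2 * Laplacian.laplacian (p t) x ≤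
          iteratedFDeriv ℝ 2 (p t) x ![curl (u t) x, curl (u t) x] :=
    fun h => hnb ⟨κ, hκ, fun t => θ * S t, t₀', ht₀'mem, h⟩
  push Not at key
  obtain ⟨t, ht, hbad⟩ := key
  have ht₁t : t ∈ Set.Ico t₁ T := ⟨(le_max_right _ _).trans ht.1, ht.2⟩
  have ht₀t : t ∈ Set.Ico t₀ T := ⟨(le_max_left _ _).trans ht.1, ht.2⟩
  -- the superlevel set `{θ S t < ‖ω‖}` is non-empty (`θ < 1`, `S t > 0`, `S t` a supremum)
  have hne : ∃ x : E3, θ * S t < ‖curl (u t) x‖ := by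
    have hlt : θ * S t < S t := by
      have := hSpos t ht₁t
      nlinarith
    have hne' : (Set.range fun x : E3 => ‖curl (u t) x‖).Nonempty := Set.range_nonempty _
    obtain ⟨_, ⟨x, rfl⟩, hx⟩ := exists_lt_of_lt_csSup hne' hlt
    exact ⟨x, hx⟩
  obtain ⟨x, hxΩ, hxbad⟩ := hbad hne
  refine ⟨t, ht₀t, x, ?_, fun y => ?_, hxbad⟩
  · exact lt_of_le_of_lt (mul_nonneg hθ.le (hSpos t ht₁t).le) hxΩ
  · exact ((mul_le_mul_of_nonneg_left (hle t ht₁t y) hθ.le).trans hxΩ.le)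

end Summit.NavierStokesRegularity.NavierStokesRegularity.Theorems.TubeAlternative.AnalyticPropagation

end
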